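import Literature.MathematicalPhysics.QuantumManyBody.BoseGasThermodynamicLimitRuelle
import HarnessLib

/-!
# Route `BECCutLineWeakDisorder`, crux `GroundStateRigidity` (stmt-AtomisticToContinuum-9072),
# line `Sketch`: the registered stub `groundStateEnergy_ne_top_of_locBdd`

Supports (does not close) stmt-AtomisticToContinuum-9072; stub `groundStateEnergy_ne_top_of_locBdd`
of line `Sketch` (lead c2). **Finite Dirichlet ground-state energy at every particle number and
box size** for pair profiles `v : ℝ → [0, ∞]` that are bounded on every `[r, ∞)`, `r > 0`
(arbitrary, even `⊤`, as `r → 0`): `E₀(N, L) = groundStateEnergy v N L ≠ ⊤` for `N ≥ 1`, `L > 0`.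

## Proof

Fix `N ≥ 1`, `L > 0`, and put `r = L / (4N)`. By hypothesis `v ≤ C` on `[r, ∞)` for some finite
`C`, so `v ≤ hc_r + C` pointwise, `hc_r = hardCorePotential r` the hard core of diameter `r`.
Adding the constant `C` to the pair potential raises the energy of a normalised trial state by at
most `N² C` (`energy_le_energy_add_const`), hence `E₀(v) ≤ ⟨Ψ, H(hc_r) Ψ⟩ + N² C` for every trial
state `Ψ`. Finally `E₀(hc_r; N, L) < ⊤` because `N` hard spheres of diameter `r` fit in the box:
Ruelle's cell subadditivity `groundStateEnergy_le_sum_cells` [Ruelle1969, §3.5.11] with `N` of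
the `N³` cells of side `r` and pitch `2r` (`N · 2r = L/2 ≤ L`), one particle per cell
(`groundStateEnergy_one_lt_top`), the cells being `r`-separated so that the range-`r` hard core
does not see across cells.
-/

noncomputable section

open MeasureTheory Filter
open scoped ENNReal NNReal Topology

namespace Summit.AtomisticToContinuum.BoseEinsteinCondensation.Theorems.GroundStateRigidity

open Literature.MathematicalPhysics.QuantumManyBody.BoseGas

namespace FiniteEnergyLocBdd

/-- Adding a constant `C` to the pair profile raises the interaction of an `N`-particle
configuration by at most `N² C` (there are `≤ N²` pairs). [folklore] -/
theorem interaction_le_interaction_add_const {N : ℕ} {v w : ℝ → ℝ≥0∞} {C : ℝ≥0∞}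
    (h : ∀ s, v s ≤ w s + C) (X : Config N) :
    interaction v X ≤ interaction w X + N * N * C := by
  calc interaction v X
      ≤ ∑ i : Fin N, ∑ j : Fin N with i < j, (w (dist (X i) (X j)) + C) :=
        Finset.sum_le_sum fun i _ => Finset.sum_le_sum fun j _ => h _
    _ = interaction w X + ∑ i : Fin N, ∑ j : Fin N with i < j, C := by
        simp only [interaction, Finset.sum_add_distrib]
    _ ≤ interaction w X + N * N * C := by
        refine add_le_add le_rfl ?_
        calc ∑ i : Fin N, ∑ j : Fin N with i < j, C ≤ ∑ _i : Fin N, ∑ _j : Fin N, C :=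
              Finset.sum_le_sum fun i _ => Finset.sum_le_sum_of_subset (Finset.filter_subset _ _)
          _ = N * N * C := by
              simp only [Finset.sum_const, Finset.card_univ, Fintype.card_fin, nsmul_eq_mul,
                mul_assoc]

/-- Adding a constant `C` to the pair profile raises the energy of a (normalised) trial state by
at most `N² C`. [folklore] -/
theorem energy_le_energy_add_const {N : ℕ} {L : ℝ} {v w : ℝ → ℝ≥0∞} {C : ℝ≥0∞}
    (h : ∀ s, v s ≤ w s + C) (Ψ : TrialState N L) :
    energy v Ψ ≤ energy w Ψ + N * N * C := by
  have hmeas : Measurable fun X => (‖Ψ.ψ X‖₊ : ℝ≥0∞) ^ 2 :=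
    measurable_ennnormSq Ψ.contDiff.continuous
  calc energy v Ψ
      ≤ ∫⁻ X, (kineticDensity Ψ.ψ X + interaction w X * (‖Ψ.ψ X‖₊ : ℝ≥0∞) ^ 2) +
          N * N * C * (‖Ψ.ψ X‖₊ : ℝ≥0∞) ^ 2 := by
        refine lintegral_mono fun X => ?_
        calc kineticDensity Ψ.ψ X + interaction v X * (‖Ψ.ψ X‖₊ : ℝ≥0∞) ^ 2
            ≤ kineticDensity Ψ.ψ X +
                (interaction w X + N * N * C) * (‖Ψ.ψ X‖₊ : ℝ≥0∞) ^ 2 :=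
              add_le_add le_rfl (mul_le_mul' (interaction_le_interaction_add_const h X) le_rfl)
          _ = _ := by ring
    _ = energy w Ψ + N * N * C * ∫⁻ X, (‖Ψ.ψ X‖₊ : ℝ≥0∞) ^ 2 := by
        rw [lintegral_add_right _ (hmeas.const_mul _), lintegral_const_mul _ hmeas]
        rfl
    _ = energy w Ψ + N * N * C := by rw [Ψ.norm_eq, mul_one]

/-- **`N` hard spheres of diameter `r` fit in a box of side `L ≥ 2 N r`**: the Dirichlet
ground-state energy of the hard-core gas is then finite. Ruelle's cell construction: `N` of the
`N³` cells of side `r` at pitch `2r`, one particle in each. [cite: Ruelle1969, §3.5.11] -/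
theorem groundStateEnergy_hardCorePotential_lt_top {N : ℕ} {r L : ℝ} (hr : 0 < r)
    (hfit : (N : ℝ) * (r + r) ≤ L) : groundStateEnergy (hardCorePotential r) N L < ⊤ := by
  have hNle : N ≤ N ^ 3 := Nat.le_self_pow (by norm_num) N
  set T : Finset (Fin (N ^ 3)) := (Finset.univ : Finset (Fin N)).map (Fin.castLEEmb hNle)
    with hT
  have hcard : ∑ _c ∈ T, (1 : ℕ) = N := by
    simp [hT]
  calc groundStateEnergy (hardCorePotential r) N L
      = groundStateEnergy (hardCorePotential r) (∑ _c ∈ T, (1 : ℕ)) L := by rw [hcard]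
    _ ≤ ∑ _c ∈ T, groundStateEnergy (hardCorePotential r) 1 r :=
        groundStateEnergy_le_sum_cells (v := hardCorePotential r) (R := r) (ℓ := r) (m := N)
          (measurable_hardCorePotential r) (fun s hs => hardCorePotential_of_le hs.le) hr.le hr
          hfit T (fun _ => 1)
    _ < ⊤ := ENNReal.sum_lt_top.2 fun _ _ => groundStateEnergy_one_lt_top _ hr

end FiniteEnergyLocBdd

/-- **Finite ground-state energy for locally bounded tails (every `N ≥ 1`, `L > 0`).** If the pair
profile `v` is bounded on every `[r, ∞)`, `r > 0` (it may blow up, even be `⊤`, as `r → 0`), then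
the Dirichlet ground-state energy `groundStateEnergy v N L` of `N ≥ 1` bosons in the box of side
`L > 0` is finite: with `r = L/(4N)` and `v ≤ C` on `[r, ∞)`, `v ≤ hardCorePotential r + C`, so
`E₀(v) ≤ E₀(hc_r) + N² C`, and `E₀(hc_r; N, L) < ⊤` since `N` hard spheres of diameter `r` fit in
the box (Ruelle's cells, one particle per cell). [cite: Ruelle1969, §3.5.11] -/
theorem groundStateEnergy_ne_top_of_locBdd :
    ∀ (N : ℕ) (v : ℝ → ℝ≥0∞) (L : ℝ), 1 ≤ N → 0 < L → Measurable v →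
      (∀ r : ℝ, 0 < r → ∃ C : ℝ≥0, ∀ s : ℝ, r ≤ s → v s ≤ C) →
      groundStateEnergy v N L ≠ ⊤ := by
  intro N v L hN hL _hv hbdd
  have hN0 : (0 : ℝ) < N := by exact_mod_cast hN
  -- hard-core diameter = cell side `r = L / (4N)`: `N` cells of pitch `2r` fit (`2 N r = L/2 ≤ L`)
  have hr : 0 < L / (4 * N) := by positivity
  have hfit : (N : ℝ) * (L / (4 * N) + L / (4 * N)) ≤ L := by
    have : (N : ℝ) * (L / (4 * N) + L / (4 * N)) = L / 2 := by
      field_simp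
      ring
    rw [this]
    linarith
  obtain ⟨C, hC⟩ := hbdd _ hr
  -- `v ≤ hc_r + C`
  have hdom : ∀ s, v s ≤ hardCorePotential (L / (4 * N)) s + C := by
    intro s
    by_cases hs : s < L / (4 * N)
    · rw [hardCorePotential_of_lt hs, top_add]
      exact le_top
    · rw [hardCorePotential_of_le (not_lt.1 hs), zero_add]
      exact hC s (not_lt.1 hs)
  -- a trial state of finite hard-core energy
  have hlt := FiniteEnergyLocBdd.groundStateEnergy_hardCorePotential_lt_top hr hfit
  unfold groundStateEnergy at hlt
  obtain ⟨Ψ, hΨ⟩ := iInf_lt_iff.1 hlt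
  refine ne_top_of_le_ne_top ?_
    ((groundStateEnergy_le_energy v Ψ).trans (FiniteEnergyLocBdd.energy_le_energy_add_const hdom Ψ))
  exact ENNReal.add_ne_top.2 ⟨hΨ.ne, ENNReal.mul_ne_top
    (ENNReal.mul_ne_top (ENNReal.natCast_ne_top N) (ENNReal.natCast_ne_top N)) ENNReal.coe_ne_top⟩

end Summit.AtomisticToContinuum.BoseEinsteinCondensation.Theorems.GroundStateRigidity

end
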